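import Literature.NumberTheory.Rogawski1990.ArchTorusOrbitalOneSidedLimitsProof   -- ★ LH3-p04 (g2): (C-bdry) for CM `L`; `exists_tendsto_nhdsGT∕LT_of_tendsto_deriv`, `differentiableAt_two_sin_mul_integral_comp_conj_splitCurve`; brings (J-nc) ★
import Literature.NumberTheory.Rogawski1990.ArchStableTorusOrbitalWallDeriv       -- ★ J1 (F0P3a-p07): `sin_mul_integral_comp_conj_splitCurve_comp_perm_eq` (relabel transport of the split-curve term), ★ `ArchLocalRelabelTransport`
import HarnessLib

/-!
# (C-bdry) FOR EVERY RELABELLED PARTNER: one-sided limits of `2 sin ψ · ∫_{G_w} Θ(x·diag(z_ψ∘ρ)·x⁻¹) dν` and the two-sided limit of its `ψ`-derivative at a NONCOMPACT wall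
# (Varadarajan 1989 §6.4 Thms 18, 20, 22; Rogawski 1990 §8.2 pp. 119, 122–124)

Topic `NumberTheory/Rogawski1990`; namespace `Literature.NumberTheory.Rogawski1990`.  THEOREMS ONLY (no `def`, no instance, no notation, no axiom, no named fact, no `sorry`).
Cell `pub/hodgecm-mathlib`, line LH3 (closer stub `stub_N9`, crux H413 = `stmt-HodgeConjecture-24833`), input of organ **(M2-01)** «the Δ″-side of `a′ ∈ C_c^∞(G′_∞)` is continuous with
its first normal derivative across a `G`-wall at an indefinite place» (LH3-plan (g2) 05:33∕05:36Z; LH3-p04 (g2) census (4)): the per-place, per-partner (C-bdry) in the THREE-LIMIT form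
the mirror argument consumes — `Jp`, `Jm` for `g_ρ(ψ) = 2 sin ψ · F_Θ(z_ψ ∘ ρ)` and ONE two-sided punctured limit `D` of `g_ρ′` (so `Dp = Dm`; the letter ★ `ArchTorusOrbitalOneSidedLimits` only asserts
four separate limits).  Author LH3-p04 (g2), 2026-09-02.

THE MATHEMATICS.  `G_w = U(σ_w diag α)(ℂ)` (diagonal real frame, `α_i ≠ 0`), Haar `ν`, `Θ` ambient-smooth with compact support on `G_w`, a split-singular base `z₀ 0 = z₀ 2 ≠ z₀ 1` and the
one-angle curve `z_ψ = (z₀₀e^{iψ}, z₀₁, z₀₀e^{−iψ})`; a relabelling `ρ ∈ S₃` whose wall — the slots `ρ⁻¹(0), ρ⁻¹(2)` carrying the coalescing pair — is NONCOMPACT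
(`re σ_w(α_{ρ⁻¹0})·re σ_w(α_{ρ⁻¹2}) < 0`).  ★ `sin_mul_integral_comp_conj_splitCurve_comp_perm_eq` transports `g_ρ` to the STANDARD curve on the relabelled group `G_w(α∘ρ⁻¹)` with the
transported test function `Θ_{ρ⁻¹}` and Haar measure `(e_{ρ⁻¹})⁻¹_*ν`; there (J-nc) ★ `archLimitFormulaNoncompactWall_holds` (CM `L`; its `νH` from ★
`exists_isHaarMeasure_isInvInvariant_centralizer_circleDiagonal_wall`) gives the two-sided limit of the derivative, ★ `differentiableAt_two_sin_mul_integral_comp_conj_splitCurve` the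
differentiability at small `ψ ≠ 0` (★ `eventually_injective_splitCurve`), and ★ `exists_tendsto_nhdsGT∕LT_of_tendsto_deriv` the one-sided limits of the function.

WHAT IS PROVED.  **`exists_tendsto_two_sin_mul_integral_comp_conj_splitCurve_comp_perm`** — `∃ Jp Jm D, Tendsto g_ρ (𝓝[>] 0) (𝓝 Jp) ∧ Tendsto g_ρ (𝓝[<] 0) (𝓝 Jm) ∧
Tendsto (deriv g_ρ) (𝓝[≠] 0) (𝓝 D)`; `…_of_id` — the un-relabelled case `ρ = 1` in the letter's own spelling (three-limit sharpening of ★ `archTorusOrbitalOneSidedLimits_holds`).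
HONEST LABEL: HC_CM is proved only modulo the 7 printed citations (2 remaining: hLiu418 = stmt-HodgeConjecture-24832, h413 = stmt-HodgeConjecture-24833) until rung 0 closes; per-place kit for
(M2-01), pays nothing by itself.

## References
* [Varadarajan1989] V. S. Varadarajan, *An Introduction to Harmonic Analysis on Semisimple Lie Groups* (1989), §6.4 Thm 18, Thm 20, Thm 22.
* [Rogawski1990] J. D. Rogawski, *Automorphic Representations of Unitary Groups in Three Variables*, Ann. of Math. Stud. 123 (1990), §8.2 pp. 119, 122–124.
-/

set_option autoImplicit false

noncomputable section

open MeasureTheory Measure Filter Topology NumberField NumberField.InfinitePlace Equiv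
open Literature.MeasureTheory.Group Literature.NumberTheory.Automorphic Literature.NumberTheory.Automorphic.UnitaryGroup Literature.Analysis.Calculus
open Literature.LinearAlgebra.Matrix
open scoped Matrix MatrixGroups Matrix.Norms.Operator

namespace Literature.NumberTheory.Rogawski1990

section Relabel

variable (L : Type) [Field L] [NumberField L] [IsCMField L] (α : Fin 3 → L) (w : {w : InfinitePlace L // IsComplex w})
  [MeasurableSpace (GL (Fin 3) ℂ)] [BorelSpace (GL (Fin 3) ℂ)]

/-- **(C-bdry) FOR THE RELABELLED PARTNER `ρ`, THREE-LIMIT FORM** at a NONCOMPACT wall: for `g_ρ(ψ) = 2 sin ψ · ∫_{G_w} Θ(↑↑(x·diag(z_ψ ∘ ρ)·x⁻¹)) dν` with `z₀ 0 = z₀ 2 ≠ z₀ 1` and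
`re σ_w(α_{ρ⁻¹0})·re σ_w(α_{ρ⁻¹2}) < 0`, there are `Jp Jm D` with `g_ρ → Jp` (`ψ → 0⁺`), `g_ρ → Jm` (`ψ → 0⁻`) and `g_ρ′ → D` (`ψ → 0`, `ψ ≠ 0`, BOTH sides).  Transport to the standard
curve on `G_w(α∘ρ⁻¹)` (★ J1), then (J-nc) ★ + the generic one-sided-limit lemma ★. [cite: Varadarajan1989, §6.4 Thm 18, Thm 20, Thm 22] [cite: Rogawski1990, §8.2 p. 119] -/
theorem exists_tendsto_two_sin_mul_integral_comp_conj_splitCurve_comp_perm (hα : ∀ i, α i ≠ 0) (hreal : ∀ i, (w.1.embedding (α i)).im = 0)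
    (ν : Measure (archLocal L 3 (Matrix.diagonal α) w)) [ν.IsHaarMeasure]
    (Θ : Matrix (Fin 3) (Fin 3) ℂ → ℂ) (hΘ : ContDiff ℝ (⊤ : ℕ∞) Θ)
    (hΘc : HasCompactSupport fun k : archLocal L 3 (Matrix.diagonal α) w => Θ (((k : GL (Fin 3) ℂ) : Matrix (Fin 3) (Fin 3) ℂ)))
    (z₀ : Fin 3 → Circle) (h02 : z₀ 0 = z₀ 2) (h01 : z₀ 0 ≠ z₀ 1) (ρ : Perm (Fin 3))
    (hnc : (w.1.embedding (α (ρ⁻¹ 0))).re * (w.1.embedding (α (ρ⁻¹ 2))).re < 0) :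
    ∃ Jp Jm D : ℂ,
      Tendsto (fun ψ : ℝ => (2 * Real.sin ψ : ℂ) * ∫ g : archLocal L 3 (Matrix.diagonal α) w,
          Θ ((((g * ⟨circleDiagonal 3 ((fun i => z₀ i * Circle.exp (![(1 : ℝ), 0, -1] i * ψ)) ∘ ⇑ρ), circleDiagonal_mem_archLocal_diagonal L 3 α w _⟩ * g⁻¹ :
            archLocal L 3 (Matrix.diagonal α) w) : GL (Fin 3) ℂ) : Matrix (Fin 3) (Fin 3) ℂ)) ∂ν) (𝓝[>] 0) (𝓝 Jp) ∧
      Tendsto (fun ψ : ℝ => (2 * Real.sin ψ : ℂ) * ∫ g : archLocal L 3 (Matrix.diagonal α) w,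
          Θ ((((g * ⟨circleDiagonal 3 ((fun i => z₀ i * Circle.exp (![(1 : ℝ), 0, -1] i * ψ)) ∘ ⇑ρ), circleDiagonal_mem_archLocal_diagonal L 3 α w _⟩ * g⁻¹ :
            archLocal L 3 (Matrix.diagonal α) w) : GL (Fin 3) ℂ) : Matrix (Fin 3) (Fin 3) ℂ)) ∂ν) (𝓝[<] 0) (𝓝 Jm) ∧
      Tendsto (fun ψ : ℝ => deriv (fun ψ : ℝ => (2 * Real.sin ψ : ℂ) * ∫ g : archLocal L 3 (Matrix.diagonal α) w,
          Θ ((((g * ⟨circleDiagonal 3 ((fun i => z₀ i * Circle.exp (![(1 : ℝ), 0, -1] i * ψ)) ∘ ⇑ρ), circleDiagonal_mem_archLocal_diagonal L 3 α w _⟩ * g⁻¹ :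
            archLocal L 3 (Matrix.diagonal α) w) : GL (Fin 3) ℂ) : Matrix (Fin 3) (Fin 3) ℂ)) ∂ν) ψ) (𝓝[≠] 0) (𝓝 D) := by
  classical
  -- transport to the standard curve on the relabelled group `G_w(α ∘ ρ⁻¹)`
  rw [sin_mul_integral_comp_conj_splitCurve_comp_perm_eq L α w ν Θ z₀ ρ]
  -- the relabelled frame, its Haar measure, the transported test function
  have hα' : ∀ i, (α ∘ ⇑ρ⁻¹) i ≠ 0 := fun i => hα (ρ⁻¹ i)
  have hreal' : ∀ i, (w.1.embedding ((α ∘ ⇑ρ⁻¹) i)).im = 0 := fun i => hreal (ρ⁻¹ i)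
  haveI : LocallyCompactSpace (archLocal L 3 (Matrix.diagonal (α ∘ ⇑ρ⁻¹)) w) := locallyCompactSpace_archLocal L 3 _ w
  haveI : SecondCountableTopology (archLocal L 3 (Matrix.diagonal (α ∘ ⇑ρ⁻¹)) w) := secondCountableTopology_archLocal L 3 _ w
  set ν' : Measure (archLocal L 3 (Matrix.diagonal (α ∘ ⇑ρ⁻¹)) w) :=
    ν.map (ContinuousMulEquiv.restrictSubgroup (GLn.conjEquiv (Matrix.GeneralLinearGroup.mkOfDetNeZero _ (det_monomial_one_ne_zero 3 ρ⁻¹)))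
      (archLocal L 3 (Matrix.diagonal (α ∘ ⇑ρ⁻¹)) w) (archLocal L 3 (Matrix.diagonal α) w) (mem_archLocal_comp_perm_iff_conj_mem L 3 α w ρ⁻¹)).symm with hν'
  haveI : ν'.IsHaarMeasure := ContinuousMulEquiv.isHaarMeasure_map ν _
  haveI : ν'.IsMulRightInvariant := isMulRightInvariant_of_modularCharacterFun_eq_one
    (modularCharacterFun_archLocal_eq_one L (Matrix.diagonal (α ∘ ⇑ρ⁻¹)) (by
      rw [Matrix.diagonal_map (map_zero _), Matrix.diagonal_transpose]
      congr 1
      funext i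
      apply w.1.embedding.injective
      change w.1.embedding (cmConjRingHom L ((α ∘ ⇑ρ⁻¹) i)) = w.1.embedding ((α ∘ ⇑ρ⁻¹) i)
      rw [embedding_cmConjRingHom]
      exact Complex.conj_eq_iff_im.mpr (hreal' i)) (by
      rw [Matrix.det_diagonal]
      exact Finset.prod_ne_zero_iff.mpr fun i _ => hα' i) w) ν'
  set Θ' : Matrix (Fin 3) (Fin 3) ℂ → ℂ := fun A => Θ ((monomial ρ⁻¹ fun _ : Fin 3 => (1 : ℂ)) * A *
      (((Matrix.GeneralLinearGroup.mkOfDetNeZero _ (det_monomial_one_ne_zero 3 ρ⁻¹))⁻¹ : GL (Fin 3) ℂ) : Matrix (Fin 3) (Fin 3) ℂ)) with hΘ'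
  have hΘ's : ContDiff ℝ (⊤ : ℕ∞) Θ' := contDiff_comp_monomial_conj 3 ρ⁻¹ Θ hΘ
  have hΘ'1 : ContDiff ℝ 1 Θ' := hΘ's.of_le (by exact_mod_cast le_top)
  have hΘ'c : HasCompactSupport fun k : archLocal L 3 (Matrix.diagonal (α ∘ ⇑ρ⁻¹)) w => Θ' (((k : GL (Fin 3) ℂ) : Matrix (Fin 3) (Fin 3) ℂ)) :=
    hasCompactSupport_comp_relabel L 3 α w ρ⁻¹ Θ hΘc
  -- (J-nc) on the relabelled group: the two-sided limit of the derivative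
  obtain ⟨νH, hH, -, hHinv⟩ := exists_isHaarMeasure_isInvInvariant_centralizer_circleDiagonal_wall L (α ∘ ⇑ρ⁻¹) w hα' hreal' h02 h01
  letI : MeasurableSpace (archLocal L 3 (Matrix.diagonal (α ∘ ⇑ρ⁻¹)) w ⧸ Subgroup.centralizer
      ({(⟨circleDiagonal 3 z₀, circleDiagonal_mem_archLocal_diagonal L 3 (α ∘ ⇑ρ⁻¹) w z₀⟩ : archLocal L 3 (Matrix.diagonal (α ∘ ⇑ρ⁻¹)) w)} :
        Set (archLocal L 3 (Matrix.diagonal (α ∘ ⇑ρ⁻¹)) w))) := borel _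
  haveI : BorelSpace (archLocal L 3 (Matrix.diagonal (α ∘ ⇑ρ⁻¹)) w ⧸ Subgroup.centralizer
      ({(⟨circleDiagonal 3 z₀, circleDiagonal_mem_archLocal_diagonal L 3 (α ∘ ⇑ρ⁻¹) w z₀⟩ : archLocal L 3 (Matrix.diagonal (α ∘ ⇑ρ⁻¹)) w)} :
        Set (archLocal L 3 (Matrix.diagonal (α ∘ ⇑ρ⁻¹)) w))) := ⟨rfl⟩
  obtain ⟨c, -, hJ⟩ := archLimitFormulaNoncompactWall_holds L (α ∘ ⇑ρ⁻¹) w hα' hreal' ν' z₀ h02 h01 hnc νH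
  have hD := hJ Θ' hΘ's hΘ'c z₀ h02 h01
  -- differentiability at all small `ψ ≠ 0`
  have hdiff : ∀ᶠ ψ in 𝓝[≠] (0 : ℝ), DifferentiableAt ℝ (fun ψ : ℝ => (2 * Real.sin ψ : ℂ) *
      ∫ g, Θ' (((g * ⟨circleDiagonal 3 (fun i => z₀ i * Circle.exp (![(1 : ℝ), 0, -1] i * ψ)),
        circleDiagonal_mem_archLocal_diagonal L 3 (α ∘ ⇑ρ⁻¹) w _⟩ * g⁻¹ : archLocal L 3 (Matrix.diagonal (α ∘ ⇑ρ⁻¹)) w) : GL (Fin 3) ℂ) : Matrix (Fin 3) (Fin 3) ℂ) ∂ν') ψ := by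
    filter_upwards [eventually_injective_splitCurve z₀ h02 h01] with ψ hψ
    exact differentiableAt_two_sin_mul_integral_comp_conj_splitCurve L (α ∘ ⇑ρ⁻¹) w hα' hreal' ν' Θ' hΘ'1 hΘ'c z₀ hψ
  have hGT : (𝓝[>] (0 : ℝ)) ≤ 𝓝[≠] 0 := nhdsWithin_mono _ fun x hx => ne_of_gt hx
  have hLT : (𝓝[<] (0 : ℝ)) ≤ 𝓝[≠] 0 := nhdsWithin_mono _ fun x hx => ne_of_lt hx
  obtain ⟨Jp, hJp⟩ := exists_tendsto_nhdsGT_of_tendsto_deriv (hdiff.filter_mono hGT) (hD.mono_left hGT)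
  obtain ⟨Jm, hJm⟩ := exists_tendsto_nhdsLT_of_tendsto_deriv (hdiff.filter_mono hLT) (hD.mono_left hLT)
  exact ⟨Jp, Jm, _, hJp, hJm, hD⟩

/-- **(C-bdry), THREE-LIMIT FORM, un-relabelled** (`ρ = 1`): the letter's own curve at a noncompact wall `re σ_w(α₀)·re σ_w(α₂) < 0` — `Jp`, `Jm` and ONE two-sided punctured limit
of the derivative (sharpening of ★ `archTorusOrbitalOneSidedLimits_holds`). [cite: Varadarajan1989, §6.4 Thm 18, Thm 20, Thm 22] [cite: Rogawski1990, §8.2 p. 119] -/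
theorem exists_tendsto_two_sin_mul_integral_comp_conj_splitCurve (hα : ∀ i, α i ≠ 0) (hreal : ∀ i, (w.1.embedding (α i)).im = 0)
    (ν : Measure (archLocal L 3 (Matrix.diagonal α) w)) [ν.IsHaarMeasure]
    (Θ : Matrix (Fin 3) (Fin 3) ℂ → ℂ) (hΘ : ContDiff ℝ (⊤ : ℕ∞) Θ)
    (hΘc : HasCompactSupport fun k : archLocal L 3 (Matrix.diagonal α) w => Θ (((k : GL (Fin 3) ℂ) : Matrix (Fin 3) (Fin 3) ℂ)))
    (z₀ : Fin 3 → Circle) (h02 : z₀ 0 = z₀ 2) (h01 : z₀ 0 ≠ z₀ 1) (hnc : (w.1.embedding (α 0)).re * (w.1.embedding (α 2)).re < 0) :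
    ∃ Jp Jm D : ℂ,
      Tendsto (fun ψ : ℝ => (2 * Real.sin ψ : ℂ) * ∫ g : archLocal L 3 (Matrix.diagonal α) w,
          Θ ((((g * ⟨circleDiagonal 3 (fun i => z₀ i * Circle.exp (![(1 : ℝ), 0, -1] i * ψ)), circleDiagonal_mem_archLocal_diagonal L 3 α w _⟩ * g⁻¹ :
            archLocal L 3 (Matrix.diagonal α) w) : GL (Fin 3) ℂ) : Matrix (Fin 3) (Fin 3) ℂ)) ∂ν) (𝓝[>] 0) (𝓝 Jp) ∧
      Tendsto (fun ψ : ℝ => (2 * Real.sin ψ : ℂ) * ∫ g : archLocal L 3 (Matrix.diagonal α) w,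
          Θ ((((g * ⟨circleDiagonal 3 (fun i => z₀ i * Circle.exp (![(1 : ℝ), 0, -1] i * ψ)), circleDiagonal_mem_archLocal_diagonal L 3 α w _⟩ * g⁻¹ :
            archLocal L 3 (Matrix.diagonal α) w) : GL (Fin 3) ℂ) : Matrix (Fin 3) (Fin 3) ℂ)) ∂ν) (𝓝[<] 0) (𝓝 Jm) ∧
      Tendsto (fun ψ : ℝ => deriv (fun ψ : ℝ => (2 * Real.sin ψ : ℂ) * ∫ g : archLocal L 3 (Matrix.diagonal α) w,
          Θ ((((g * ⟨circleDiagonal 3 (fun i => z₀ i * Circle.exp (![(1 : ℝ), 0, -1] i * ψ)), circleDiagonal_mem_archLocal_diagonal L 3 α w _⟩ * g⁻¹ :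
            archLocal L 3 (Matrix.diagonal α) w) : GL (Fin 3) ℂ) : Matrix (Fin 3) (Fin 3) ℂ)) ∂ν) ψ) (𝓝[≠] 0) (𝓝 D) :=
  exists_tendsto_two_sin_mul_integral_comp_conj_splitCurve_comp_perm L α w hα hreal ν Θ hΘ hΘc z₀ h02 h01 1 (by simpa using hnc)

end Relabel

end Literature.NumberTheory.Rogawski1990

end
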